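import Literature.MathematicalPhysics.QuantumFieldTheory.Balaban1983to89.T4ObservableTelescopeTwoRun

/-!
# `Balaban1983to89.T4UniformDefectWiring` — the (W1) WIRING of observable-level telescoping: a per-step TERMWISE DATUM
# («the realised ℝ-step acts by the concrete (0.3)» + «per-term conditional-mean gaps for the pulled-back loop product» +
# «a mass-weighted budget geometric in the scale distance») CLOSES `T4ObservableTelescopeTwoRun.UniformGeomDefect` BY NAME;
# signed weights; far terms free; the mass identity; the two-channel merge; the end-to-end existence corollaries
# (cell T4, node O3b/H2 = NE1′ → U5; bookkeeping)

HONEST FRAMING.  Audit cell `pub-balaban`, unit `b2b-balaban-t4-ne1p-p3-g4` (T⁴-continuum fan-out, PROVER seat P3 for the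
spine estimate NE1′ = DRESSED STABILITY in the observable-attached format, lineage generation 4; journal row
`T4-O3.E-NE1′-PROVE-P3d*`, companion record `HOME/t4/T4-EST-NE1p-P3.md` v4 §9).  ASSIGNED TECHNIQUE of the seat (unchanged):
«observable-level telescoping: write ⟨F⟩ differences as telescoping sums over scales and bound each increment by the printed
one-step contraction + the μ-derivative of the effective action».  Generations 1–3 (`T4ObservableTelescope`,
`T4ObservableTelescopeTwoRun`) proved the exact identities, the summation lemmas and the existence theorems of the lane and
LOCATED its two not-printed inputs: (W1) `UniformGeomDefect D g₀` — K-uniform, geometric-in-the-distance sizes of the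
normalised ℝ-defects of ONE run — and (W2) the undressed two-run good/bad datum at a free level (`MidGoodBadRate` /
`LadderGoodBadRate`; its relocation half is inhabited by `T4RunLadder.runLadder` of the `t4-lean` lineage).  THIS MODULE is
the kernel half of (W1) that was still missing (cell HANDOFF of `b2b-balaban-pv16-g12`: «(W1) wiring = t4-ne1p-p3»): it proves
that `UniformGeomDefect` FOLLOWS from a per-step datum stated ENTIRELY in generation 1's one-term language — so that the
per-term suppliers of the cell (`T4CondMeanChannel.abs_termDefect_le_of_suppression`, `T4CondMeanChannelInsert`, the
pair-response chart/window modules of the `pv16` lineage, and whatever discharges GAPS G-ne1p3-1 / G-ne1p3-2) have ONE typed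
target to meet and nothing to re-derive about runs, distances, normalisations or signs.  The cell's T4 target is the
existence and uniqueness of the continuum limit of unit-scale averaged loop expectations on a FINITE torus with Bałaban's
densities as GIVEN data and the printed end statement (B) and the β-hypothesis as HYPOTHESES (the prefix
`T4Continuum.FiniteEpsData.UnderHypotheses`); it is NOT an infinite-volume statement, NOT a mass gap, NOT the Clay problem,
and this module is NOT progress on any summit.  Every conditional of the cell (BetaPertH, (B), (B^μ)) is ABSENT from §1–§5
(nothing there is about Bałaban's estimates) and is the explicit antecedent of `UnderHypotheses` in the three target
corollaries of §6; none is hidden in a definition.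

CITATION HEADER.  From T. Bałaban's series (CMP 1984–89) this module takes ONLY what the imported tree modules already quote
and model, re-used BY NAME: the concrete shape of the large-field operation [Balaban1989LargeFieldI] (0.3)/(0.4) p. 176 and of
one term of (1.100)–(1.102) p. 201 as modelled by `B15.BasicStep.RopReal` / `normTerm` / `fibreIntegral` with the printed
proviso «the denominators are positive» (`T4ObservableTelescope.TermProvisos.den_ne`); the order of the operations
[Balaban1988Convergent] (0.2) p. 244 «ρ_k = RTρ_{k−1}» (`T4Continuum.Realisation.rho_succ_eq`, `T4ObservableTelescope.
PrintedChain`); the renormalisation transformations as push-forwards (`Setup.IsRT`, `Realisation.isRT_Trho`; total mass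
[Balaban1985UV3] (6) p. 257 via `T4Spectator.integral_eq_of_isRT`).  No page of the series was newly read for this module; no
sentence is newly attributed to it; nothing of Bałaban's averaging, small-field densities, minimisers or R beyond the cited
tree shapes is encoded (cell DIVERGENCE F6/F9 honoured).  In particular the identification «Bałaban's ℝ′ of (1.100)/(1.101)
acts on Tρ_k TERM BY TERM by the (0.3) shape» (cell T4-DAG §2 O3a, certified there as STRUCTURE, a model reading) is NOT
asserted: it is the DATA `TermRep` below, to be supplied.  ABSOLUTE RULE honoured: no programme-internal statement is a
hypothesis-free input — every representation, every gap and every budget enters as a binder; every declaration is [folklore]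
bookkeeping.

WHAT IS PROVED (all [folklore]; no `sorry`, no new axiom):
§1 SIGNED WEIGHTS, CONSTANTS, FAR TERMS (one term of (0.3), abstract lattice).  Generation 1's conditional-mean size
   `abs_termDefect_le_of_condMeanGap` asks the weight to be NONNEGATIVE; the lane's weights are loop PRODUCTS, which are signed
   (`|∏ W_C| ≤ 1`).  Proved: the conditional mean of `g + c` is that of `g` plus `c` at every live exterior
   (`condMean_add_const`); `CondMeanGap` is invariant under `g ↦ g + c` (`condMeanGap_add_const`, both laws live by the
   printed proviso); hence `|termDefect s ins old g| ≤ ε·∫dV old` for EVERY bounded measurable `g` with `CondMeanGap … g ε`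
   (`abs_termDefect_le_of_condMeanGap'`: shift by the bound, the one-term defect of a constant vanishes by
   `termDefect_eq_zero_of_fibreIndep'`); a weight independent of the term's fibre variables has gap `0` under the provisos
   (`condMeanGap_zero_of_fibreIndep` — TERMS AWAY FROM THE OBSERVABLE ARE FREE in the gap currency, not only in the defect
   currency of generation 1's `termDefect_eq_zero_of_fibreIndep'`); monotonicity (`condMeanGap_mono`).
§2 THE TERMWISE DATUM OF ONE STEP.  `TermRep σ Rj` — the DATA of a (0.3)-representation of the action of an operation `Rj` on a
   density `σ`: a finite term type `ι`, pieces `ρ(Z,·)`, partners `Z″ = pp Z`, fibres `Z′ = fib Z`, the printed provisos of every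
   term (with a per-term bound), `σ = Σ_Z ρ(Z,·)` pointwise and `Rj σ = RopReal piece pp fib` — EXACTLY the hypotheses of
   generation 1's `defect_eq_sum_termDefect`, bundled, with nothing added.  Proved: the defect of every bounded measurable
   weight is the sum of the one-term defects (`TermRep.defect_eq_sum`); THE MASS IDENTITY `Σ_Z ∫ρ(Z,·) = ∫σ`
   (`TermRep.sum_integral_piece`); per-term gaps `ε_Z` for a SIGNED weight give `|defect σ Rj g| ≤ Σ_Z ε_Z·∫ρ(Z,·)`
   (`TermRep.abs_defect_le_sum`), and a UNIFORM gap `η` gives `|defect σ Rj g| ≤ η·∫σ` (`TermRep.abs_defect_le_of_supGap`) —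
   «(sup over terms of the conditional-mean gap) × (total mass)», NO COUNT OF TERMS: the number of terms of (0.3) never enters;
   what the cell calls «the count» (T4-DAG §2 O3a, B13 (2.30)) lives INSIDE each `ε_Z` as the number of fibre bonds the
   pulled-back loop sees (record §3 (CM)), not in this sum.
§3 DISTANCE ↔ STEP, CAST-FREE.  For a run of length `k + 1 + n` the summand of the telescoping sum at scale distance `n` IS the
   defect at step `k` of the weight pulled back to level `k + 1`:
   `distDefect av Tρ R (k+1+n) f n = defect (Tρ k) (R k) (pullback av (k+1) n f)` (`distDefect_add_eq`, structural recursion;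
   generation 3's `pullback`) — the bridge between generation 2's distance currency and generation 1's one-step language.
§4 THE WIRING (the cell's data `D : T4Continuum.FiniteEpsData`).  `∫Tρ_k^{(K)} = ∫ρ_K^{(K)}` for `k < K` (`integral_Trho_eq`:
   `IsRT` at weight 1 + (0.4), by name).  HYPOTHESIS SHAPES, per string of loop labels: `StepGapBudget D g₀ Cs a k n` — for the
   step `k` of the run `K = k+1+n` there are a `TermRep` of `(Tρ_k^{(K)}, R_k^{(K)})` and per-term gaps `ε_Z` for the loop
   product pulled back to level `k+1` (`loopPullback`) with `Σ_Z ε_Z·∫ρ(Z,·) ≤ a·∫ρ_K^{(K)}`; `UniformTermwiseGap D g₀` — the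
   same with `a = C·rⁿ`, `0 ≤ C`, `0 ≤ r < 1`, for all `(k, n)`; `UniformSupGap D g₀` — a `TermRep` and the UNIFORM per-term
   gap `C·rⁿ` for all `(k, n)`.  THEOREMS: `|normDefect D g₀ (k+1+n) Cs n| ≤ a` from `StepGapBudget … a k n`
   (`abs_normDefect_le_of_stepGapBudget`); `UniformTermwiseGap D g₀ → UniformGeomDefect D g₀`
   (`uniformGeomDefect_of_termwise`); `UniformSupGap → UniformTermwiseGap` by the mass identity
   (`stepGapBudget_of_supGap`, `uniformTermwiseGap_of_supGap`) and `→ UniformGeomDefect` (`uniformGeomDefect_of_supGap`).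
§5 ARITHMETIC OF THE LOCATED VERDICT (bare reals).  Two channels merge into one ratio:
   `A₁r₁ⁿ + A₂r₂ⁿ ≤ (A₁+A₂)·max(r₁,r₂)ⁿ` (`two_channel_le`) — `UniformGeomDefect` allows ONE `(C, r)` per string while the
   record's (CM) verdict has two channels `(L⁴θ₁φ)ⁿ` (first order) and `(L⁴θ₂)ⁿ` (second order); and the product condition in
   kernel form: «(bonds seen) × (per-bond rate)» `N·Λⁿ·(e·σⁿ) = (N·e)·(Λσ)ⁿ` (`count_mul_rate_eq`), geometric iff `Λσ < 1` —
   with `Λ = L⁴`: the oscillation rate `σ = θ₁ = L⁻³` gives `Λσ = L ≥ 1` (record §3 (F), FIRES), the conditional-mean rates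
   `σ = θ₁φ = L⁻⁵` and `σ = θ₂ = L⁻⁶` give `L⁻¹`, `L⁻²` (record §3 (CM)).  Nothing here asserts any of these rates.
§6 END TO END.  `HasContinuumLimit (D.scheme g₀)` from `UniformSupGap` (resp. `UniformTermwiseGap`) + an injected rate + the
   ladder good/bad datum (`hasContinuumLimit_of_supGap_ladder`, `hasContinuumLimit_of_termwise_ladder`, through generation
   3's `hasContinuumLimit_of_ladder`); the bundled supplier data `TermwiseRateTelescopeData` with
   `⇒ MidRateTelescopeData` and the three targets `ym4_torus_continuum_limit_exists/unique/exists'_of_termwise` under the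
   cell's explicit prefix `UnderHypotheses (BetaPertHyp D.βfun)` resp. `(DagBinding.EndpointExistence D.C.toB12)`.

WHAT IS NOT PROVED.  No `TermRep` of Bałaban's realised ℝ-steps (the cell's reading of (1.100)/(1.101) as a term-by-term (0.3)
action is a model reading, T4-DAG §2 O3a; the data type `FiniteEpsData` records `R` abstractly); no conditional-mean gap of
any size for any of his densities (GAPS G-ne1p3-1: the lane's missing inequality, `CondMeanGap (fib t) (ins t) (old t) g ε_t`
with `ε_t ≲ R_k^{O(1)}[(θ₁φ)ⁿ(Lip_old+Lip_ins)α₀ + θ₂ⁿ(m₂(old)+m₂(ins))]·(bonds seen)`, and G-ne1p3-2: `m₂`, `Lip` under law (I)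
— both NOT PRINTED, B16 p. 356 defers observables); no rate `θ₁`, `φ`, `θ₂`; no instance of (W2); NE1′ itself; anything about
(B), (B^μ) or the β-functions.  The instance binder `[∀ K j, DecidableEq (PBond (F.P K) j)]` of §4/§6 is bookkeeping (fibre
integration over a `Finset` of bonds); any decidability instance may be supplied, the statements do not depend on the choice
up to `Subsingleton.elim`.
-/

noncomputable section

open MeasureTheory Filter Topology
open scoped BigOperators

namespace Literature.MathematicalPhysics.QuantumFieldTheory.Balaban1983to89.T4UniformDefectWiring

open T4ObservableTelescope T4ObservableTelescopeTwoRun T4Spectator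

/-! ## §1 Signed weights, constants, far terms (one term of (0.3)) -/

section Signed

open B15.BasicStep T4DressedR T4DressingDefect

variable {P : Params} {j : ℕ} {G : Type*} [GaugeGroup G] [MeasurableSpace G] [HaarData G]
variable [DecidableEq (PBond P j)]

/-- The conditional mean of `g + c` is the conditional mean of `g` plus `c`, at every exterior field where the fibre law is
non-degenerate (linearity + the conditional law is a probability measure there). [folklore] -/
theorem condMean_add_const (s : Finset (PBond P j)) {w : Density P j G} {C : ℝ} (hC : ∀ U, w U ≤ C)
    {g : Density P j G} (hg : Measurable g) {B : ℝ} (hB : ∀ U, |g U| ≤ B) (c : ℝ) (V : GaugeField P j G)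
    (hne : fibreIntegral s w V ≠ 0) :
    condMean s w (fun U => g U + c) V = condMean s w g V + c := by
  have e : (fun U => g U + c) = fun U => g U - (fun _ : GaugeField P j G => -c) U := by
    funext U
    ring
  rw [e, condMean_sub s hC hg measurable_const hB (g₂ := fun _ : GaugeField P j G => -c) (B₂ := |c|)
      (fun _ => (abs_neg c).le) V,
    condMean_of_fibreIndep s hC (m := fun _ : GaugeField P j G => -c) (fun _ _ => rfl) V hne]
  ring

/-- `CondMeanGap` IS INVARIANT UNDER ADDING A CONSTANT TO THE WEIGHT (both fibre laws are live at the exteriors that count: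
the old term's by assumption, the insert's by the printed proviso «the denominators are positive»). [folklore] -/
theorem condMeanGap_add_const {s : Finset (PBond P j)} {ins old : Density P j G} {C : ℝ} (hP : TermProvisos s ins old C)
    {g : Density P j G} (hg : Measurable g) {B : ℝ} (hB : ∀ U, |g U| ≤ B) (c : ℝ) {ε : ℝ}
    (h : CondMeanGap s ins old g ε) : CondMeanGap s ins old (fun U => g U + c) ε := by
  intro V hne
  rw [condMean_add_const s hP.old_le hg hB c V hne, condMean_add_const s hP.ins_le hg hB c V (hP.den_ne V),
    add_sub_add_right_eq_sub]
  exact h V hne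

/-- **THE CONDITIONAL-MEAN SIZE OF ONE INCREMENT FOR A SIGNED WEIGHT**: under the printed provisos of one term, for EVERY
bounded measurable weight `g` (no sign condition) with `CondMeanGap s ins old g ε`,
`|termDefect s ins old g| ≤ ε·∫dV old` — generation 1's `abs_termDefect_le_of_condMeanGap` applied to `g + B ≥ 0`, the
one-term defect of the constant `B` being zero (`termDefect_eq_zero_of_fibreIndep'`).  This is the form the lane needs: its
weights are pulled-back loop PRODUCTS, `|∏ W_C| ≤ 1`, signed. [folklore] -/
theorem abs_termDefect_le_of_condMeanGap' {s : Finset (PBond P j)} {ins old : Density P j G} {C : ℝ}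
    (hP : TermProvisos s ins old C) {g : Density P j G} (hg : Measurable g) {B : ℝ} (hB : ∀ U, |g U| ≤ B) {ε : ℝ}
    (hε : CondMeanGap s ins old g ε) :
    |termDefect s ins old g| ≤ ε * ∫ V, old V ∂fieldMeasure P j G := by
  have h0 : ∀ U, 0 ≤ g U + B := fun U => by
    have h := (neg_le_abs (g U)).trans (hB U)
    linarith
  have hle : ∀ U, g U + B ≤ B + B := fun U => by linarith [(le_abs_self (g U)).trans (hB U)]
  have hB' : ∀ U, |g U + B| ≤ B + B := fun U => by
    rw [abs_of_nonneg (h0 U)]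
    exact hle U
  have e : termDefect s ins old g = termDefect s ins old (fun U => g U + B) := by
    have h := termDefect_sub hP (g₁ := fun U => g U + B) (g₂ := fun _ : GaugeField P j G => B) (hg.add_const B) hB'
      measurable_const (B₂ := |B|) (fun _ => le_rfl)
    rw [termDefect_eq_zero_of_fibreIndep' hP (m := fun _ : GaugeField P j G => B) measurable_const (fun _ _ => rfl)
      (Bm := |B|) (fun _ => le_rfl), sub_zero] at h
    refine Eq.trans ?_ h
    congr 1
    funext V
    simp
  rw [e]
  exact abs_termDefect_le_of_condMeanGap hP (hg.add_const B) h0 hle (condMeanGap_add_const hP hg hB B hε)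

/-- **TERMS AWAY FROM THE OBSERVABLE ARE FREE IN THE GAP CURRENCY**: a weight independent of the term's fibre variables has
conditional-mean gap `0` under the printed provisos (its conditional mean under either law is the weight itself,
`condMean_of_fibreIndep`). [folklore] -/
theorem condMeanGap_zero_of_fibreIndep {s : Finset (PBond P j)} {ins old : Density P j G} {C : ℝ}
    (hP : TermProvisos s ins old C) {g : Density P j G} (hgI : FibreIndep s g) : CondMeanGap s ins old g 0 := by
  intro V hne
  rw [condMean_of_fibreIndep s hP.old_le hgI V hne, condMean_of_fibreIndep s hP.ins_le hgI V (hP.den_ne V), sub_self,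
    abs_zero]

/-- Monotonicity of the gap size. [folklore] -/
theorem condMeanGap_mono {s : Finset (PBond P j)} {ins old : Density P j G}
    {g : GaugeField P j G → ℝ} {ε ε' : ℝ} (h : CondMeanGap s ins old g ε) (hle : ε ≤ ε') : CondMeanGap s ins old g ε' :=
  fun V hne => (h V hne).trans hle

/-- The printed provisos with a bound `C` hold with every larger bound. [folklore] -/
theorem termProvisos_mono {s : Finset (PBond P j)} {ins old : Density P j G} {C C' : ℝ} (hP : TermProvisos s ins old C)
    (hle : C ≤ C') : TermProvisos s ins old C' :=
  ⟨hP.ins_meas, hP.old_meas, hP.ins_nonneg, hP.old_nonneg, fun V => (hP.ins_le V).trans hle,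
    fun V => (hP.old_le V).trans hle, hP.den_ne⟩

end Signed

/-! ## §2 The termwise datum of one step: a (0.3)-representation, the defect as a sum, the mass identity, the two bounds -/

section Rep

open B15.BasicStep T4DressedR T4DressingDefect

variable {P : Params} {j : ℕ} {G : Type*} [GaugeGroup G] [MeasurableSpace G] [HaarData G]
variable [DecidableEq (PBond P j)]

/-- DATA — A (0.3)-REPRESENTATION OF THE ACTION OF `Rj` ON `σ` (hypotheses of generation 1's `defect_eq_sum_termDefect`,
bundled; NOTHING asserts such a representation of Bałaban's realised ℝ-steps — the cell's reading of
[Balaban1989LargeFieldI] (1.100)/(1.101) p. 201 as a term-by-term instance of (0.3) p. 176 is a model reading, T4-DAG §2 O3a):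
a finite type of terms `ι` («histories» `Z`), pieces `piece Z = ρ(Z,·)`, partners `pp Z = Z″` (the insert `ρ(Z″,·)`), fibres
`fib Z = Z′` (a `Finset` of positive bonds), the printed provisos of every term with a per-term bound, `σ = Σ_Z ρ(Z,·)`
pointwise, and `Rj σ = Σ_Z ρ(Z″,·)·∫⌈_{Z′}ρ(Z,·)/∫⌈_{Z′}ρ(Z″,·)` (`RopReal`). [folklore] -/
structure TermRep (σ : Density P j G) (Rj : Density P j G → Density P j G) where
  /-- the finite type of terms -/
  ι : Type
  /-- finiteness of the term type -/
  [instFintype : Fintype ι]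
  /-- the pieces `ρ(Z,·)` -/
  piece : ι → Density P j G
  /-- the partner `Z″` of a term (its insert is `piece (pp Z)`) -/
  pp : ι → ι
  /-- the fibre `Z′` of a term -/
  fib : ι → Finset (PBond P j)
  /-- a per-term common bound of insert and integrated density -/
  bound : ι → ℝ
  /-- the printed provisos of every term -/
  provisos : ∀ Z, TermProvisos (fib Z) (piece (pp Z)) (piece Z) (bound Z)
  /-- (0.2): the density is the sum of its pieces -/
  sum_eq : ∀ V, σ V = ∑ Z, piece Z V
  /-- (0.3): the operation acts on it by the normalised replacement terms -/
  rop_eq : Rj (fun V => ∑ Z, piece Z V) = RopReal piece pp fib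

attribute [instance] TermRep.instFintype

namespace TermRep

variable {σ : Density P j G} {Rj : Density P j G → Density P j G} (ρr : TermRep σ Rj)

/-- A common bound for all terms: `Σ_Z |bound Z|`. [folklore] -/
def commonBound : ℝ := ∑ Z, |ρr.bound Z|

/-- Every term's provisos hold with the common bound. [folklore] -/
theorem provisos_common (Z : ρr.ι) : TermProvisos (ρr.fib Z) (ρr.piece (ρr.pp Z)) (ρr.piece Z) ρr.commonBound :=
  termProvisos_mono (ρr.provisos Z) ((le_abs_self _).trans
    (Finset.single_le_sum (f := fun Z => |ρr.bound Z|) (fun _ _ => abs_nonneg _) (Finset.mem_univ Z)))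

/-- `σ = Σ_Z ρ(Z,·)` as functions. [folklore] -/
theorem sum_eq' : σ = fun V => ∑ Z, ρr.piece Z V := funext ρr.sum_eq

/-- **THE DEFECT IS THE SUM OF THE ONE-TERM DEFECTS** (generation 1's `defect_eq_sum_termDefect`, by name). [folklore] -/
theorem defect_eq_sum {g : Density P j G} (hg : Measurable g) {B : ℝ} (hgB : ∀ V, |g V| ≤ B) :
    defect σ Rj g = ∑ Z, termDefect (ρr.fib Z) (ρr.piece (ρr.pp Z)) (ρr.piece Z) g :=
  (congrArg (fun x : Density P j G => defect x Rj g) ρr.sum_eq').trans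
    (defect_eq_sum_termDefect ρr.piece ρr.pp ρr.fib ρr.provisos_common ρr.rop_eq hg hgB)

/-- **THE MASS IDENTITY**: `Σ_Z ∫dV ρ(Z,·) = ∫dV σ`. [folklore] -/
theorem sum_integral_piece : ∑ Z, ∫ V, ρr.piece Z V ∂fieldMeasure P j G = ∫ V, σ V ∂fieldMeasure P j G := by
  rw [← integral_finsetSum Finset.univ (fun Z _ => (ρr.provisos Z).integrable_old)]
  exact integral_congr_ae (Filter.Eventually.of_forall fun V => (ρr.sum_eq V).symm)

/-- The total mass of the pieces is nonnegative. [folklore] -/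
theorem sum_integral_piece_nonneg : 0 ≤ ∑ Z, ∫ V, ρr.piece Z V ∂fieldMeasure P j G :=
  Finset.sum_nonneg fun Z _ => integral_nonneg (ρr.provisos Z).old_nonneg

/-- **PER-TERM GAPS ⇒ THE STEP'S DEFECT, SIGNED WEIGHT**: if every term satisfies `CondMeanGap` for the bounded measurable
weight `g` with its own `ε_Z`, then `|defect σ Rj g| ≤ Σ_Z ε_Z·∫dV ρ(Z,·)` (generation 1's `abs_defect_ropReal_le_sum` without
the sign condition, via §1). [folklore] -/
theorem abs_defect_le_sum {g : Density P j G} (hg : Measurable g) {B : ℝ} (hgB : ∀ V, |g V| ≤ B) {ε : ρr.ι → ℝ}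
    (hε : ∀ Z, CondMeanGap (ρr.fib Z) (ρr.piece (ρr.pp Z)) (ρr.piece Z) g (ε Z)) :
    |defect σ Rj g| ≤ ∑ Z, ε Z * ∫ V, ρr.piece Z V ∂fieldMeasure P j G := by
  rw [ρr.defect_eq_sum hg hgB]
  exact (Finset.abs_sum_le_sum_abs _ _).trans
    (Finset.sum_le_sum fun Z _ => abs_termDefect_le_of_condMeanGap' (ρr.provisos Z) hg hgB (hε Z))

/-- **A UNIFORM GAP ⇒ «GAP × TOTAL MASS», NO COUNT OF TERMS**: if every term has gap `≤ η` for `g`, then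
`|defect σ Rj g| ≤ η·∫dV σ` (the mass identity). [folklore] -/
theorem abs_defect_le_of_supGap {g : Density P j G} (hg : Measurable g) {B : ℝ} (hgB : ∀ V, |g V| ≤ B) {η : ℝ}
    (hη : ∀ Z, CondMeanGap (ρr.fib Z) (ρr.piece (ρr.pp Z)) (ρr.piece Z) g η) :
    |defect σ Rj g| ≤ η * ∫ V, σ V ∂fieldMeasure P j G := by
  have h := ρr.abs_defect_le_sum hg hgB (ε := fun _ => η) hη
  have e : ∑ Z, η * ∫ V, ρr.piece Z V ∂fieldMeasure P j G = η * ∫ V, σ V ∂fieldMeasure P j G := by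
    rw [← Finset.mul_sum, ρr.sum_integral_piece]
  exact h.trans (le_of_eq e)

/-- NEAR/FAR FORM: if every term whose fibre the weight depends on has gap `≤ η` (`0 ≤ η`) and the weight is independent of
the fibre variables of all other terms, the uniform bound holds (far terms have gap `0`, §1). [folklore] -/
theorem abs_defect_le_of_nearGap {g : Density P j G} (hg : Measurable g) {B : ℝ} (hgB : ∀ V, |g V| ≤ B) {η : ℝ}
    (hη0 : 0 ≤ η) (near : ρr.ι → Prop)
    (hnear : ∀ Z, near Z → CondMeanGap (ρr.fib Z) (ρr.piece (ρr.pp Z)) (ρr.piece Z) g η)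
    (hfar : ∀ Z, ¬ near Z → FibreIndep (ρr.fib Z) g) :
    |defect σ Rj g| ≤ η * ∫ V, σ V ∂fieldMeasure P j G := by
  refine ρr.abs_defect_le_of_supGap hg hgB fun Z => ?_
  by_cases hZ : near Z
  · exact hnear Z hZ
  · exact condMeanGap_mono (condMeanGap_zero_of_fibreIndep (ρr.provisos Z) (hfar Z hZ)) hη0

end TermRep

end Rep

/-! ## §3 Distance ↔ step, cast-free: the summand at distance `n` of a run of length `k + 1 + n` is the defect at step `k` of
the weight pulled back to level `k + 1` -/

section DistPullback

variable {P : Params} {G : Type*} [GaugeGroup G] [MeasurableSpace G] [HaarData G]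
variable (av : ∀ j, Averaging P j G) (Tρ : (k : ℕ) → Density P (k + 1) G)
  (R : (k : ℕ) → Density P (k + 1) G → Density P (k + 1) G)

/-- **`distDefect (k+1+n) f n = defect (Tρ k) (R k) (pullback (k+1) n f)`** — by structural recursion on `n`
(`k + 1 + (n+1)` and `(k + 1 + n) + 1` agree by computation, as in generation 3's `midIntegral_add_eq`). [folklore] -/
theorem distDefect_add_eq :
    ∀ (n k : ℕ) (f : GaugeField P (k + 1 + n) G → ℝ),
      distDefect av Tρ R (k + 1 + n) f n = defect (Tρ k) (R k) (pullback av (k + 1) n f)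
  | 0, _, _ => rfl
  | n + 1, k, f => distDefect_add_eq n k (fun U => f ((av (k + 1 + n)).avg U))

end DistPullback

/-! ## §4 The wiring: termwise data along the cell's runs ⇒ `UniformGeomDefect` -/

section Cell

open T4Continuum Missing T4CauchySum

variable {F : T4Family} {G : Type*} [GaugeGroup G] [MeasurableSpace G] [HaarData G]
variable [∀ K j : ℕ, DecidableEq (PBond (F.P K) j)]

omit [∀ K j : ℕ, DecidableEq (PBond (F.P K) j)] in
/-- `k < k + 1 + n`: the step `k` lies inside the run of length `k + 1 + n`. [folklore] -/
theorem lt_add_one_add (k n : ℕ) : k < k + 1 + n :=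
  Nat.lt_of_lt_of_le (Nat.lt_succ_self k) (Nat.le_add_right _ _)

omit [∀ K j : ℕ, DecidableEq (PBond (F.P K) j)] in
/-- **THE MASS OF `Tρ_k^{(K)}` IS `∫ρ_K^{(K)}`** for `k < K`: the T-step preserves total mass (`IsRT` at weight 1,
`T4Spectator.integral_eq_of_isRT`) and so does every later step (`integral_rho_level_eq`, (0.4)). [folklore] -/
theorem integral_Trho_eq (D : FiniteEpsData F G) (K : ℕ) (g : ℝ) {k : ℕ} (hk : k < K) :
    ∫ V, D.real.Trho K g k V ∂fieldMeasure (F.P K) (k + 1) G = ∫ V, rho D K g K V ∂fieldMeasure (F.P K) K G :=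
  (integral_eq_of_isRT ((printedChain_rho D K g).isRT k hk)).trans (integral_rho_level_eq D K g hk.le)

omit [∀ K j : ℕ, DecidableEq (PBond (F.P K) j)] in
/-- THE LOOP PRODUCT OF RUN `k + 1 + n` PULLED BACK TO LEVEL `k + 1` (generation 3's `pullback` of generation 2's `prodLoop`):
the weight whose one-step ℝ-defect at step `k` is the run's summand at distance `n` (§3). [folklore] -/
abbrev loopPullback (D : FiniteEpsData F G) (Cs : List (ULoop F)) (k n : ℕ) :
    GaugeField (F.P (k + 1 + n)) (k + 1) G → ℝ :=
  pullback (D.av (k + 1 + n)) (k + 1) n (prodLoop (k + 1 + n) Cs)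

omit [∀ K j : ℕ, DecidableEq (PBond (F.P K) j)] in
/-- The pulled-back loop product is measurable (measurable averagings, regular gauge group). [folklore] -/
theorem measurable_loopPullback [RegularGaugeGroup G] (D : FiniteEpsData F G) (hM : D.AvgMeasurable)
    (Cs : List (ULoop F)) (k n : ℕ) : Measurable (loopPullback D Cs k n) :=
  measurable_pullback _ (hM _) (k + 1) n _ (measurable_prodLoop _ Cs)

omit [∀ K j : ℕ, DecidableEq (PBond (F.P K) j)] in
/-- … and bounded by `1`. [folklore] -/
theorem abs_loopPullback_le_one [RegularGaugeGroup G] (D : FiniteEpsData F G) (Cs : List (ULoop F)) (k n : ℕ)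
    (U : GaugeField (F.P (k + 1 + n)) (k + 1) G) : |loopPullback D Cs k n U| ≤ 1 :=
  abs_pullback_le _ (k + 1) n _ (abs_prodLoop_le_one _ Cs) U

/-- HYPOTHESIS SHAPE — THE TERMWISE DATUM OF ONE STEP WITH A MASS-WEIGHTED BUDGET `a` (per string `Cs`, step `k`, distance
`n`, run `K = k+1+n`; NOT PRINTED, never asserted — GAPS G-ne1p3-1 and G-ne1p3-2 are its sizes): a (0.3)-representation of the realised
step `(Tρ_k^{(K)}, R_k^{(K)})` and per-term conditional-mean gaps `ε_Z` for the loop product pulled back to level `k+1`, with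
`Σ_Z ε_Z·∫ρ(Z,·) ≤ a·∫ρ_K^{(K)}`.  (The representation is allowed to depend on `(Cs, n)` only because a hypothesis is the weaker
for it; Bałaban's would not.) [folklore] -/
def StepGapBudget (D : FiniteEpsData F G) (g₀ : ℕ → ℝ) (Cs : List (ULoop F)) (a : ℝ) (k n : ℕ) : Prop :=
  ∃ ρr : TermRep (D.real.Trho (k + 1 + n) (g₀ (k + 1 + n)) k) (D.real.R (k + 1 + n) (g₀ (k + 1 + n)) k),
    ∃ ε : ρr.ι → ℝ,
      (∀ Z, CondMeanGap (ρr.fib Z) (ρr.piece (ρr.pp Z)) (ρr.piece Z) (loopPullback D Cs k n) (ε Z)) ∧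
      ∑ Z, ε Z * ∫ V, ρr.piece Z V ∂fieldMeasure (F.P (k + 1 + n)) (k + 1) G
        ≤ a * ∫ V, rho D (k + 1 + n) (g₀ (k + 1 + n)) (k + 1 + n) V ∂fieldMeasure (F.P (k + 1 + n)) (k + 1 + n) G

/-- HYPOTHESIS SHAPE — (W1) IN TERMWISE FORM: per string, `0 ≤ C`, `0 ≤ r < 1` and `StepGapBudget … (C·rⁿ) k n` for every step
`k` and distance `n`. [folklore] -/
def UniformTermwiseGap (D : FiniteEpsData F G) (g₀ : ℕ → ℝ) : Prop :=
  ∀ Cs : List (ULoop F), ∃ C r : ℝ, 0 ≤ C ∧ 0 ≤ r ∧ r < 1 ∧ ∀ k n, StepGapBudget D g₀ Cs (C * r ^ n) k n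

/-- HYPOTHESIS SHAPE — (W1) IN SUP-GAP FORM (the located shape of record §3 (CM): «every term's conditional-mean gap for the
loop product pulled back `n` levels is `≤ C·rⁿ`», the count of bonds seen and the rates `θ₁φ`, `θ₂` living inside `C·rⁿ`):
per string, `0 ≤ C`, `0 ≤ r < 1`, and for every `(k, n)` a (0.3)-representation of the realised step with the UNIFORM per-term
gap `C·rⁿ`. [folklore] -/
def UniformSupGap (D : FiniteEpsData F G) (g₀ : ℕ → ℝ) : Prop :=
  ∀ Cs : List (ULoop F), ∃ C r : ℝ, 0 ≤ C ∧ 0 ≤ r ∧ r < 1 ∧ ∀ k n,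
    ∃ ρr : TermRep (D.real.Trho (k + 1 + n) (g₀ (k + 1 + n)) k) (D.real.R (k + 1 + n) (g₀ (k + 1 + n)) k),
      ∀ Z, CondMeanGap (ρr.fib Z) (ρr.piece (ρr.pp Z)) (ρr.piece Z) (loopPullback D Cs k n) (C * r ^ n)

/-- **ONE SUMMAND**: `StepGapBudget … a k n ⇒ |normDefect D g₀ (k+1+n) Cs n| ≤ a` (§3 + §2 + `∫ρ_K > 0`). [folklore] -/
theorem abs_normDefect_le_of_stepGapBudget [RegularGaugeGroup G] (D : FiniteEpsData F G) (hM : D.AvgMeasurable)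
    (g₀ : ℕ → ℝ) (Cs : List (ULoop F)) {a : ℝ} {k n : ℕ} (h : StepGapBudget D g₀ Cs a k n) :
    |normDefect D g₀ (k + 1 + n) Cs n| ≤ a := by
  obtain ⟨ρr, ε, hε, hbud⟩ := h
  have hZ := integral_rho_pos D (k + 1 + n) (g₀ (k + 1 + n))
  rw [normDefect, distDefect_add_eq, abs_div, abs_of_pos hZ, div_le_iff₀ hZ]
  exact (ρr.abs_defect_le_sum (measurable_loopPullback D hM Cs k n) (abs_loopPullback_le_one D Cs k n) hε).trans hbud

/-- **(W1) WIRED: `UniformTermwiseGap D g₀ → UniformGeomDefect D g₀`** (every run `K > n` is `k + 1 + n`). [folklore] -/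
theorem uniformGeomDefect_of_termwise [RegularGaugeGroup G] (D : FiniteEpsData F G) (hM : D.AvgMeasurable)
    (g₀ : ℕ → ℝ) (h : UniformTermwiseGap D g₀) : UniformGeomDefect D g₀ := by
  intro Cs
  obtain ⟨C, r, hC, hr0, hr1, hkn⟩ := h Cs
  refine ⟨C, r, hC, hr0, hr1, fun K n hn => ?_⟩
  obtain ⟨k, rfl⟩ : ∃ k, K = k + 1 + n := ⟨K - 1 - n, by omega⟩
  exact abs_normDefect_le_of_stepGapBudget D hM g₀ Cs (hkn k n)

/-- **THE SUP-GAP FORM FEEDS THE BUDGET FORM** with the same constant, by the mass identity `Σ_Z ∫ρ(Z,·) = ∫Tρ_k = ∫ρ_K`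
(§2, `integral_Trho_eq`). [folklore] -/
theorem stepGapBudget_of_supGap (D : FiniteEpsData F G) (g₀ : ℕ → ℝ) (Cs : List (ULoop F)) {a : ℝ} {k n : ℕ}
    (ρr : TermRep (D.real.Trho (k + 1 + n) (g₀ (k + 1 + n)) k) (D.real.R (k + 1 + n) (g₀ (k + 1 + n)) k))
    (hη : ∀ Z, CondMeanGap (ρr.fib Z) (ρr.piece (ρr.pp Z)) (ρr.piece Z) (loopPullback D Cs k n) a) :
    StepGapBudget D g₀ Cs a k n := by
  refine ⟨ρr, fun _ => a, hη, le_of_eq ?_⟩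
  have e : ∑ Z, a * ∫ V, ρr.piece Z V ∂fieldMeasure (F.P (k + 1 + n)) (k + 1) G
      = a * ∫ V, rho D (k + 1 + n) (g₀ (k + 1 + n)) (k + 1 + n) V ∂fieldMeasure (F.P (k + 1 + n)) (k + 1 + n) G := by
    rw [← Finset.mul_sum, ρr.sum_integral_piece, integral_Trho_eq D (k + 1 + n) (g₀ (k + 1 + n)) (lt_add_one_add k n)]
  exact e

/-- `UniformSupGap → UniformTermwiseGap`. [folklore] -/
theorem uniformTermwiseGap_of_supGap (D : FiniteEpsData F G) (g₀ : ℕ → ℝ) (h : UniformSupGap D g₀) :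
    UniformTermwiseGap D g₀ := by
  intro Cs
  obtain ⟨C, r, hC, hr0, hr1, hkn⟩ := h Cs
  refine ⟨C, r, hC, hr0, hr1, fun k n => ?_⟩
  obtain ⟨ρr, hη⟩ := hkn k n
  exact stepGapBudget_of_supGap D g₀ Cs ρr hη

/-- **(W1) WIRED, SUP-GAP FORM: `UniformSupGap D g₀ → UniformGeomDefect D g₀`.** [folklore] -/
theorem uniformGeomDefect_of_supGap [RegularGaugeGroup G] (D : FiniteEpsData F G) (hM : D.AvgMeasurable)
    (g₀ : ℕ → ℝ) (h : UniformSupGap D g₀) : UniformGeomDefect D g₀ :=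
  uniformGeomDefect_of_termwise D hM g₀ (uniformTermwiseGap_of_supGap D g₀ h)

end Cell

/-! ## §5 Arithmetic of the located verdict (bare reals): two channels, one ratio; count × rate -/

section Arith

/-- **TWO CHANNELS MERGE INTO ONE RATIO**: `A₁r₁ⁿ + A₂r₂ⁿ ≤ (A₁ + A₂)·max(r₁,r₂)ⁿ` — so a supplier with a first-order channel
(ratio `L⁴θ₁φ` in the record's (CM) verdict) and a second-order channel (ratio `L⁴θ₂`) meets the ONE `(C, r)` of
`UniformSupGap` / `UniformGeomDefect` with `r = max`, still `< 1` when both are. [folklore] -/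
theorem two_channel_le {A₁ A₂ r₁ r₂ : ℝ} (hA₁ : 0 ≤ A₁) (hA₂ : 0 ≤ A₂) (hr₁ : 0 ≤ r₁) (hr₂ : 0 ≤ r₂) (n : ℕ) :
    A₁ * r₁ ^ n + A₂ * r₂ ^ n ≤ (A₁ + A₂) * max r₁ r₂ ^ n := by
  rw [add_mul]
  exact add_le_add (mul_le_mul_of_nonneg_left (pow_le_pow_left₀ hr₁ (le_max_left _ _) n) hA₁)
    (mul_le_mul_of_nonneg_left (pow_le_pow_left₀ hr₂ (le_max_right _ _) n) hA₂)

/-- `max r₁ r₂ < 1` when both are. [folklore] -/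
theorem max_lt_one {r₁ r₂ : ℝ} (h₁ : r₁ < 1) (h₂ : r₂ < 1) : max r₁ r₂ < 1 := max_lt h₁ h₂

/-- **COUNT × RATE = ONE GEOMETRIC FACTOR**: «(bonds seen at distance `n`) × (per-bond rate)» `N·Λⁿ·(e·σⁿ) = (N·e)·(Λσ)ⁿ` —
the kernel form of the located product condition: geometric iff `Λσ < 1` (`Λ = L⁴`; `σ = θ₁ = L⁻³` gives `L`, record §3 (F);
`σ = θ₁φ = L⁻⁵`, `σ = θ₂ = L⁻⁶` give `L⁻¹`, `L⁻²`, record §3 (CM)).  No rate is asserted. [folklore] -/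
theorem count_mul_rate_eq (N Λ e σ : ℝ) (n : ℕ) : N * Λ ^ n * (e * σ ^ n) = N * e * (Λ * σ) ^ n := by
  rw [mul_pow]
  ring

/-- … and the product is a ratio `< 1` exactly when `Λ·σ < 1`; with `0 ≤ Λ`, `0 ≤ σ` it is `≥ 0`. [folklore] -/
theorem prod_rate_nonneg {Λ σ : ℝ} (hΛ : 0 ≤ Λ) (hσ : 0 ≤ σ) : 0 ≤ Λ * σ := mul_nonneg hΛ hσ

end Arith

/-! ## §6 End to end: existence from the termwise datum + an injected rate + the ladder good/bad datum; the targets -/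

section EndToEnd

open T4Continuum Missing T4CauchySum

variable {F : T4Family} {G : Type*} [GaugeGroup G] [MeasurableSpace G] [HaarData G]
variable [∀ K j : ℕ, DecidableEq (PBond (F.P K) j)]

/-- **EXISTENCE FROM THE TERMWISE (W1) DATUM, A RUN LADDER AND THE GOOD/BAD DATUM ALONG IT** (generation 3's
`hasContinuumLimit_of_ladder` with (W1) discharged by §4). [folklore] -/
theorem hasContinuumLimit_of_termwise_ladder [RegularGaugeGroup G] (D : FiniteEpsData F G) (hM : D.AvgMeasurable)
    (R : RunLadder D) (g₀ : ℕ → ℝ) (hW : UniformTermwiseGap D g₀) {C θ E ρ Λ : ℝ} {c : ℕ} {inj : ℕ → ℕ → ℝ}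
    (hinj : InjectedRate C c θ inj) (hE : 0 ≤ E) (hθ : 0 ≤ θ) (hθ1 : θ < 1) (hρ : 0 ≤ ρ) (hρ1 : ρ < 1) (hΛ : 1 ≤ Λ)
    (h : LadderGoodBadRate D R g₀ Λ E ρ inj) : HasContinuumLimit (D.scheme g₀) :=
  hasContinuumLimit_of_ladder D hM R g₀ (uniformGeomDefect_of_termwise D hM g₀ hW) hinj hE hθ hθ1 hρ hρ1 hΛ h

/-- The same from the sup-gap form. [folklore] -/
theorem hasContinuumLimit_of_supGap_ladder [RegularGaugeGroup G] (D : FiniteEpsData F G) (hM : D.AvgMeasurable)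
    (R : RunLadder D) (g₀ : ℕ → ℝ) (hW : UniformSupGap D g₀) {C θ E ρ Λ : ℝ} {c : ℕ} {inj : ℕ → ℕ → ℝ}
    (hinj : InjectedRate C c θ inj) (hE : 0 ≤ E) (hθ : 0 ≤ θ) (hθ1 : θ < 1) (hρ : 0 ≤ ρ) (hρ1 : ρ < 1) (hΛ : 1 ≤ Λ)
    (h : LadderGoodBadRate D R g₀ Λ E ρ inj) : HasContinuumLimit (D.scheme g₀) :=
  hasContinuumLimit_of_ladder D hM R g₀ (uniformGeomDefect_of_supGap D hM g₀ hW) hinj hE hθ hθ1 hρ hρ1 hΛ h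

/-- THE SUPPLIER-LEVEL DATA OF THE FREE-LEVEL ROUTE WITH (W1) IN TERMWISE FORM, bundled: `UniformTermwiseGap` and a
mid-level discrepancy rate under an injected rate (generation 3's `MidRateTelescopeData` with its first conjunct replaced by
the termwise datum). [folklore] -/
def TermwiseRateTelescopeData (D : FiniteEpsData F G) (g₀ : ℕ → ℝ) : Prop :=
  UniformTermwiseGap D g₀ ∧ ∃ (C θ E ρ Λ : ℝ) (c : ℕ) (inj : ℕ → ℕ → ℝ), InjectedRate C c θ inj ∧ 0 ≤ E ∧ 0 ≤ θ ∧
    θ < 1 ∧ 0 ≤ ρ ∧ ρ < 1 ∧ 1 ≤ Λ ∧ MidDiscrepancyRate D g₀ Λ E ρ inj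

/-- `TermwiseRateTelescopeData ⇒ MidRateTelescopeData` (§4). [folklore] -/
theorem midRateTelescopeData_of_termwise [RegularGaugeGroup G] (D : FiniteEpsData F G) (hM : D.AvgMeasurable)
    (g₀ : ℕ → ℝ) (h : TermwiseRateTelescopeData D g₀) : MidRateTelescopeData D g₀ :=
  ⟨uniformGeomDefect_of_termwise D hM g₀ h.1, h.2⟩

/-- **TARGET `ym4_torus_continuum_limit_exists` ⇐ the termwise (W1) datum + a mid-level discrepancy rate, under the cell's
prefix** (β-hypothesis `BetaPertHyp` and (B) explicit in `UnderHypotheses`). [folklore] -/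
theorem ym4_torus_continuum_limit_exists_of_termwise [RegularGaugeGroup G] (D : FiniteEpsData F G)
    (hM : D.AvgMeasurable) (h : D.UnderHypotheses (BetaPertHyp D.βfun) fun g₀ => TermwiseRateTelescopeData D g₀) :
    D.ym4_torus_continuum_limit_exists :=
  ym4_torus_continuum_limit_exists_of_midRate D hM
    (FiniteEpsData.UnderHypotheses.mono (fun g₀ hg => midRateTelescopeData_of_termwise D hM g₀ hg) h)

/-- … and the uniqueness target. [cite: MagnenRivasseauSeneor1993, p.326] -/
theorem ym4_torus_continuum_limit_unique_of_termwise [RegularGaugeGroup G] (D : FiniteEpsData F G)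
    (hM : D.AvgMeasurable) (h : D.UnderHypotheses (BetaPertHyp D.βfun) fun g₀ => TermwiseRateTelescopeData D g₀) :
    D.ym4_torus_continuum_limit_unique :=
  D.limit_unique_of_limit_exists (ym4_torus_continuum_limit_exists_of_termwise D hM h)

/-- PRINT-FAITHFUL FORM of the existence target from the termwise supplier-level data. [cite: Balaban1987RG1, Thm 2 p.259] -/
theorem ym4_torus_continuum_limit_exists'_of_termwise [RegularGaugeGroup G] (D : FiniteEpsData F G)
    (hM : D.AvgMeasurable)
    (h : D.UnderHypotheses (DagBinding.EndpointExistence D.C.toB12) fun g₀ => TermwiseRateTelescopeData D g₀) :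
    D.ym4_torus_continuum_limit_exists' :=
  ym4_torus_continuum_limit_exists'_of_midRate D hM
    (FiniteEpsData.UnderHypotheses.mono (fun g₀ hg => midRateTelescopeData_of_termwise D hM g₀ hg) h)

end EndToEnd

end Literature.MathematicalPhysics.QuantumFieldTheory.Balaban1983to89.T4UniformDefectWiring
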